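import Literature.AlgebraicGeometry.Motives.GenericFibreCycles
import Literature.AlgebraicGeometry.Motives.ClosedSubvarietyOfPoint
import Literature.AlgebraicGeometry.Motives.CyclesEquivalencesFlatPullbackProofs
import Literature.AlgebraicGeometry.Motives.SubschemeCyclesFundamentalProofs
import Mathlib.AlgebraicGeometry.Geometrically.Integral
import Mathlib.AlgebraicGeometry.AffineSpace
import Mathlib.RingTheory.Flat.Basic
import Mathlib.RingTheory.RingHom.FinitePresentation
import Mathlib.Algebra.MvPolynomial.Equiv
import HarnessLib

/-!
# The trivial affine line bundle `p : 𝔸¹ ×ₖ T → T`: fibres, relative dimension, and `p^*` on prime cycles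

Preparations for Fulton, *Intersection Theory*, §1.9 (Prop. 1.9: for an affine bundle
`p : E → X`, `p^* : A_k X → A_{k+n} E` is surjective; "In particular, `A_k(𝔸ⁿ)` is zero for
`k < n`", p. 23), whose printed proof (p. 22–23, read in the held copy) reduces to `E = X × 𝔸¹`
and argues with the subvarieties `V ⊆ X × 𝔸¹`: "If `dim X = k`, then `V = E`, so `V = p^*[X]`"
and, for the non-dominant components, "Therefore `Vᵢ = p⁻¹(Wᵢ)`, with `Wᵢ = p(Vᵢ)`". This file
provides exactly these two geometric inputs on the tree's carriers (`Motives/Cycles`,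
`Motives/SubschemeCycles`: cycles graded by `Order.height`, flat pull-back `flatPullback`), for a
field `k`, a `k`-scheme `T`, `𝔸¹_k = Spec k[X]` (`AffineLineProduct.𝔸₁ k = specOver k k[X]`) and
the projection `p = snd : 𝔸¹ ×ₖ T → T` (`AffineLineProduct.proj`, the cartesian monoidal
structure of `SchemeOver k`):

* instances: `𝔸¹_k → Spec k` is locally of finite type / finite presentation, flat,
  quasi-compact, geometrically irreducible, reduced and integral (Mathlib's instances for
  `𝔸(ι; S) → S` transported along `𝔸(ι; Spec k) ≅ Spec k[ι] ≅ Spec k[X]`,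
  `AffineSpace.SpecIso_inv_over`, `MvPolynomial.uniqueAlgEquiv`); hence **`𝔸¹ ×ₖ T` is integral
  for `T` integral** and locally Noetherian (Mathlib: geometrically integral flat universally
  open base change of an integral scheme).
* `fiberIso t : p⁻¹(t) ≅ Spec κ(t)[X]` — **the fibres are affine lines** (pullback pasting,
  Mathlib `pullbackSpecIso`, `polyEquivTensor`); so they are integral, their generic point has
  height `1` (`height_genericPoint_fiber`) and **`p` has relative dimension `1`**
  (`isEquidimensional_proj`, the hypothesis of Fulton's Thm. 1.7 in the tree's form).
* `height_eq_height_base_add`, `height_le_height_base_add_one`,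
  `asFiber_eq_genericPoint_of_height_eq` — **`dim closure {v} ≤ dim closure {p v} + 1`, with
  equality iff `v` is the generic point of its fibre** (dimension formula, Stacks 02JW, through
  `Scheme.height_eq_height_add_height_asFiber` of `Motives/SubschemeCyclesDimProofs`).
* `closure_eq_preimage_closure_of_asFiber_eq`, `closure_fibreGeneric` — **a fibre-generic point
  has closure `p⁻¹(closure {p v})`** ("`Vᵢ = p⁻¹(Wᵢ)`"; the flat `p` is generalising, Mathlib
  `Flat.generalizingMap`).
* `flatPullback_primeCycle`, `primeCycle_eq_flatPullback_of_height_eq` — **`p^*[closure {w}] =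
  [p⁻¹(closure {w})]` is the PRIME cycle of the generic point of the fibre over `w`** (Fulton
  Lemma 1.7.1, the tree's `flatPullback_cycle_eq_cycle_preimage_holds`, applied to the subvariety
  `ClosedSubvariety.ofPoint T w`, whose inverse image scheme is the integral
  `𝔸¹ ×ₖ closure {w}`, `preimageOfPointIso`, with `fundamentalCycle_of_isIntegral_holds`); hence a
  subvariety of `𝔸¹ ×ₖ T` of dimension one more than its image is `p^*` of its image
  ("`V = p^*[X]`").

Everything is proved; no named facts. What is NOT here (sequels): the principal divisor
`[div r]` of Fulton's proof (the dominant case `dim X = k + 1`, computed over the generic fibre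
`𝔸¹_{K(X)}`), the surjectivity of `p^*` modulo rational equivalence, and `A_k(𝔸ⁿ) = 0`.

## References

* [Fulton1998] W. Fulton, *Intersection Theory*, 2nd ed. (1998), §1.9, Prop. 1.9 and its proof
  (pp. 22–23), Lemma 1.7.1, §1.5.
* [StacksProject] The Stacks Project, Tag 02JW (dimension formula).
-/

noncomputable section

open CategoryTheory CategoryTheory.Limits AlgebraicGeometry Order MonoidalCategory Polynomial

universe u

namespace Literature.AlgebraicGeometry.Motives

namespace AffineLineProduct

variable (k : Type u) [Field k]

/-- `𝔸¹_k = Spec k[X]` as a `k`-scheme. [folklore] -/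
abbrev 𝔸₁ : SchemeOver k := specOver k k[X]

/-- `𝔸¹_k → Spec k` is locally of finite type. [folklore] -/
instance : LocallyOfFiniteType (𝔸₁ k).hom := by
  change LocallyOfFiniteType (Spec.map (CommRingCat.ofHom (algebraMap k k[X])))
  rw [HasRingHomProperty.Spec_iff (P := @LocallyOfFiniteType)]
  exact RingHom.finiteType_algebraMap.mpr inferInstance

/-- `𝔸¹_k → Spec k` is flat. [folklore] -/
instance : Flat (𝔸₁ k).hom := by
  change Flat (Spec.map (CommRingCat.ofHom (algebraMap k k[X])))
  rw [HasRingHomProperty.Spec_iff (P := @Flat)]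
  exact RingHom.flat_algebraMap_iff.mpr inferInstance

/-- `𝔸¹_k → Spec k` is quasi-compact. [folklore] -/
instance : QuasiCompact (𝔸₁ k).hom := by
  change QuasiCompact (Spec.map (CommRingCat.ofHom (algebraMap k k[X])))
  infer_instance

/-- `𝔸¹_k → Spec k` is locally of finite presentation. [folklore] -/
instance : LocallyOfFinitePresentation (𝔸₁ k).hom := by
  change LocallyOfFinitePresentation (Spec.map (CommRingCat.ofHom (algebraMap k k[X])))
  rw [HasRingHomProperty.Spec_iff (P := @LocallyOfFinitePresentation)]
  exact RingHom.finitePresentation_algebraMap.mpr inferInstance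

/-- The ring isomorphism `k[ULift (Fin 1)] ≅ k[X]` (one variable; Mathlib
`MvPolynomial.uniqueAlgEquiv`). [folklore] -/
def mvPolyULiftIso : CommRingCat.of (MvPolynomial (ULift.{u} (Fin 1)) k) ≅ CommRingCat.of k[X] :=
  (MvPolynomial.uniqueAlgEquiv k (ULift.{u} (Fin 1))).toRingEquiv.toCommRingCatIso

/-- `Spec k[X] → Spec k` factors as `Spec` of `k → k[ULift (Fin 1)] ≅ k[X]`. [folklore] -/
theorem hom_eq_comp :
    CommRingCat.ofHom (algebraMap k k[X]) =
      CommRingCat.ofHom (MvPolynomial.C : k →+* MvPolynomial (ULift.{u} (Fin 1)) k) ≫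
        (mvPolyULiftIso k).hom := by
  ext r : 2
  change algebraMap k k[X] r =
    (MvPolynomial.uniqueAlgEquiv k (ULift.{u} (Fin 1))) (MvPolynomial.C r)
  rw [← MvPolynomial.algebraMap_eq]
  exact ((MvPolynomial.uniqueAlgEquiv k (ULift.{u} (Fin 1))).commutes r).symm

/-- `𝔸¹_k → Spec k` is geometrically irreducible (Mathlib's instance for `𝔸(ι; S) → S`,
transported along `𝔸(ι; Spec k) ≅ Spec k[ι] ≅ Spec k[X]`). [folklore] -/
instance : GeometricallyIrreducible (𝔸₁ k).hom := by
  have h𝔸 : GeometricallyIrreducible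
      (Spec.map (CommRingCat.ofHom (MvPolynomial.C : k →+* MvPolynomial (ULift.{u} (Fin 1)) k))) := by
    rw [← AffineSpace.SpecIso_inv_over (n := ULift.{u} (Fin 1)) (.of k)]
    infer_instance
  change GeometricallyIrreducible (Spec.map (CommRingCat.ofHom (algebraMap k k[X])))
  rw [hom_eq_comp, Spec.map_comp]
  exact (MorphismProperty.cancel_left_of_respectsIso @GeometricallyIrreducible _ _).mpr h𝔸

/-- `𝔸¹_k → Spec k` is geometrically reduced (same transport). [folklore] -/
instance : GeometricallyReduced (𝔸₁ k).hom := by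
  have h𝔸 : GeometricallyReduced
      (Spec.map (CommRingCat.ofHom (MvPolynomial.C : k →+* MvPolynomial (ULift.{u} (Fin 1)) k))) := by
    rw [← AffineSpace.SpecIso_inv_over (n := ULift.{u} (Fin 1)) (.of k)]
    exact (MorphismProperty.cancel_left_of_respectsIso @GeometricallyReduced _ _).mpr inferInstance
  change GeometricallyReduced (Spec.map (CommRingCat.ofHom (algebraMap k k[X])))
  rw [hom_eq_comp, Spec.map_comp]
  exact (MorphismProperty.cancel_left_of_respectsIso @GeometricallyReduced _ _).mpr h𝔸

/-- `𝔸¹_k → Spec k` is geometrically integral. [folklore] -/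
instance : GeometricallyIntegral (𝔸₁ k).hom :=
  GeometricallyIntegral.of_geometricallyReduced_of_geometricallyIrreducible _

variable (T : SchemeOver k)

/-- The projection `p : 𝔸¹ ×ₖ T → T`. [folklore] -/
abbrev proj : 𝔸₁ k ⊗ T ⟶ T := CartesianMonoidalCategory.snd (𝔸₁ k) T

/-- `p : 𝔸¹ ×ₖ T → T` is flat (base change of the flat `𝔸¹_k → Spec k`). [folklore] -/
instance : Flat (proj k T).left := inferInstanceAs (Flat (pullback.snd (𝔸₁ k).hom T.hom))

/-- `p : 𝔸¹ ×ₖ T → T` is locally of finite type. [folklore] -/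
instance : LocallyOfFiniteType (proj k T).left :=
  inferInstanceAs (LocallyOfFiniteType (pullback.snd (𝔸₁ k).hom T.hom))

/-- `p : 𝔸¹ ×ₖ T → T` is quasi-compact. [folklore] -/
instance : QuasiCompact (proj k T).left :=
  inferInstanceAs (QuasiCompact (pullback.snd (𝔸₁ k).hom T.hom))

/-- **`𝔸¹ ×ₖ T` is integral for `T` integral** (and locally Noetherian): `𝔸¹_k → Spec k` is
geometrically integral, flat and universally open (Mathlib). [folklore] -/
instance [IsIntegral T.left] [IsLocallyNoetherian T.left] : IsIntegral (𝔸₁ k ⊗ T).left :=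
  inferInstanceAs (IsIntegral (pullback (𝔸₁ k).hom T.hom))

/-! ### The fibres of `p : 𝔸¹ ×ₖ T → T` are affine lines `𝔸¹_{κ(t)}` -/

section Fibre

open TensorProduct

variable {k T} (t : ↥T.left)

/-- The `k`-algebra structure on the residue field `κ(t)` of a point of the `k`-scheme `T`
(through `Spec κ(t) → T → Spec k`). [folklore] -/
abbrev residueFieldAlgebra : Algebra k (T.left.residueField t) :=
  (Spec.preimage (T.left.fromSpecResidueField t ≫ T.hom)).hom.toAlgebra

attribute [local instance] residueFieldAlgebra

/-- `Spec κ(t) → T → Spec k` is `Spec` of the structure map `k → κ(t)`. [folklore] -/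
theorem fromSpecResidueField_comp_hom :
    T.left.fromSpecResidueField t ≫ T.hom =
      Spec.map (CommRingCat.ofHom (algebraMap k (T.left.residueField t))) := by
  rw [show CommRingCat.ofHom (algebraMap k (T.left.residueField t)) =
    Spec.preimage (T.left.fromSpecResidueField t ≫ T.hom) from rfl, Spec.map_preimage]

/-- `k[X] ⊗ₖ κ(t) ≅ κ(t)[X]` as `k`-algebras (Mathlib `polyEquivTensor`). [folklore] -/
def tensorResidueFieldAlgEquiv :
    k[X] ⊗[k] T.left.residueField t ≃ₐ[k] (T.left.residueField t)[X] :=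
  (Algebra.TensorProduct.comm k k[X] (T.left.residueField t)).trans
    (polyEquivTensor k (T.left.residueField t)).symm

/-- **The fibre of `𝔸¹ ×ₖ T → T` over `t` is the affine line `Spec κ(t)[X]`**:
`(𝔸¹ ×ₖ T) ×_T Spec κ(t) ≅ 𝔸¹ ×ₖ Spec κ(t) ≅ Spec (k[X] ⊗ₖ κ(t)) ≅ Spec κ(t)[X]`
(pullback pasting, Mathlib `pullbackSpecIso`, `polyEquivTensor`). [folklore] -/
def fiberIso : (proj k T).left.fiber t ≅ Spec (CommRingCat.of (T.left.residueField t)[X]) :=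
  pullbackLeftPullbackSndIso (𝔸₁ k).hom T.hom (T.left.fromSpecResidueField t) ≪≫
    pullback.congrHom rfl (fromSpecResidueField_comp_hom t) ≪≫
      pullbackSpecIso k k[X] (T.left.residueField t) ≪≫
        Scheme.Spec.mapIso (tensorResidueFieldAlgEquiv t).toRingEquiv.toCommRingCatIso.symm.op

/-- The fibre `(𝔸¹ ×ₖ T)_t` is homeomorphic to `Spec κ(t)[X]`. [folklore] -/
def fiberHomeo : ↥((proj k T).left.fiber t) ≃ₜ ↥(Spec (CommRingCat.of (T.left.residueField t)[X])) :=
  TopCat.homeoOfIso ((Scheme.forgetToTop).mapIso (fiberIso t))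

/-- The fibres of `𝔸¹ ×ₖ T → T` are integral schemes (affine lines over fields). [folklore] -/
instance isIntegral_fiber : IsIntegral ((proj k T).left.fiber t) :=
  haveI : Nonempty ↥((proj k T).left.fiber t) :=
    ⟨(fiberIso t).inv.base (genericPoint ↥(Spec (CommRingCat.of (T.left.residueField t)[X])))⟩
  isIntegral_of_isOpenImmersion (fiberIso t).hom

/-- `dim 𝔸¹_K = 1`: the generic point of `Spec K[X]` (`K` a field) has height `1` in the
specialisation order. [folklore] -/
theorem height_genericPoint_spec_polynomial (K : Type u) [Field K] :
    height (genericPoint ↥(Spec (CommRingCat.of K[X]))) = 1 := by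
  have h1 : height (genericPoint ↥(Spec (CommRingCat.of K[X]))) =
      coheight (⊥ : PrimeSpectrum K[X]) := by
    rw [genericPoint_eq_bot_of_affine,
      ← Order.height_orderIso (specOrderIsoPrimeSpectrum (.of K[X])),
      specOrderIsoPrimeSpectrum_apply, Order.height_toDual]
  rw [h1]
  have h2 : (coheight (⊥ : PrimeSpectrum K[X]) : WithBot ℕ∞) = 1 := by
    rw [Order.coheight_bot_eq_krullDim, ← ringKrullDim,
      Polynomial.ringKrullDim_of_isNoetherianRing, ringKrullDim_eq_zero_of_field, zero_add]
  exact_mod_cast h2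

/-- In an irreducible scheme, a point maximal for the specialisation order is the generic point.
[folklore] -/
theorem eq_genericPoint_of_isMax {Y : Scheme.{u}} [IrreducibleSpace ↥Y] {y : ↥Y} (hy : IsMax y) :
    y = genericPoint ↥Y :=
  have hle : y ≤ genericPoint ↥Y := Scheme.le_iff_specializes.mpr (genericPoint_specializes y)
  ((Scheme.le_iff_specializes.mp (hy hle)).antisymm (Scheme.le_iff_specializes.mp hle)).eq

/-- **The generic point of a fibre of `𝔸¹ ×ₖ T → T` has height `1`** (`dim 𝔸¹_{κ(t)} = 1`).
[folklore] -/
theorem height_genericPoint_fiber :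
    height (genericPoint ↥((proj k T).left.fiber t)) = 1 := by
  have h := height_eq_of_homeomorph (fiberHomeo t) (genericPoint ↥((proj k T).left.fiber t))
  rw [← h]
  have hgen : fiberHomeo t (genericPoint ↥((proj k T).left.fiber t)) =
      genericPoint ↥(Spec (CommRingCat.of (T.left.residueField t)[X])) := by
    apply eq_genericPoint_of_isMax
    have hmax : IsMax (genericPoint ↥((proj k T).left.fiber t)) :=
      fun b _ ↦ Scheme.le_iff_specializes.mpr (genericPoint_specializes b)
    exact (orderIsoOfHomeomorph (fiberHomeo t)).isMax_apply.mpr hmax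
  rw [hgen]
  exact height_genericPoint_spec_polynomial _

end Fibre

/-! ### Points of `𝔸¹ ×ₖ T`: dimension over the base, fibre-generic points -/

section Points

variable {k T}

/-- The points of a fibre of `𝔸¹ ×ₖ T → T` have height `≤ 1` (they lie below the generic point
of the affine line `𝔸¹_{κ(t)}`). [folklore] -/
theorem height_le_one_of_fiber {t : ↥T.left} (z : ↥((proj k T).left.fiber t)) : height z ≤ 1 := by
  rw [← height_genericPoint_fiber t]
  exact height_mono (Scheme.le_iff_specializes.mpr (genericPoint_specializes z))

/-- A point of a fibre of height `1` is the generic point of the fibre. [folklore] -/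
theorem eq_genericPoint_of_height_eq_one {t : ↥T.left} {z : ↥((proj k T).left.fiber t)}
    (hz : height z = 1) : z = genericPoint ↥((proj k T).left.fiber t) := by
  by_contra hne
  have hle : z ≤ genericPoint _ := Scheme.le_iff_specializes.mpr (genericPoint_specializes z)
  have hlt : z < genericPoint _ := lt_iff_le_not_ge.mpr ⟨hle, fun hge ↦ hne
    ((Scheme.le_iff_specializes.mp hge).antisymm (Scheme.le_iff_specializes.mp hle)).eq⟩
  have h := height_add_one_le hlt
  rw [height_genericPoint_fiber t, hz] at h
  exact absurd h (by decide)

/-- **`𝔸¹ ×ₖ T → T` has relative dimension `1`** (every irreducible component of every fibre —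
here the single component `𝔸¹_{κ(t)}` — has dimension `1`), the hypothesis of Fulton's Thm. 1.7
in the tree's form `IsEquidimensional`. [folklore] -/
theorem isEquidimensional_proj : (proj k T).left.IsEquidimensional 1 := by
  intro t z hz
  rw [eq_genericPoint_of_isMax hz, height_genericPoint_fiber t, Nat.cast_one]

/-- **Fibre-generic points have pull-back closures**: if `v ∈ 𝔸¹ ×ₖ T` is the generic point of
its fibre over `w = p v`, then `closure {v} = p⁻¹(closure {w})`. The inclusion `⊇` uses that the
flat morphism `p` is generalising (Mathlib `Flat.generalizingMap`): a point `u` over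
`closure {w}` generalises to a point `u'` over `w`, which lies in the fibre of `v`, hence below
`v`. (Fulton, proof of Prop. 1.9: "Therefore `Vᵢ = p⁻¹(Wᵢ)`, with `Wᵢ = p(Vᵢ)`".)
[cite: Fulton1998, Prop. 1.9 (proof)] -/
theorem closure_eq_preimage_closure_of_asFiber_eq {v : ↥(𝔸₁ k ⊗ T).left}
    (hv : (proj k T).left.asFiber v = genericPoint _) :
    closure {v} = (proj k T).left.base ⁻¹' closure {(proj k T).left.base v} := by
  apply le_antisymm
  · exact closure_minimal
      (Set.singleton_subset_iff.mpr (subset_closure (Set.mem_singleton _)))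
      ((isClosed_closure).preimage (proj k T).left.continuous)
  · intro u hu
    rw [Set.mem_preimage, ← specializes_iff_mem_closure] at hu
    -- `w ⤳ p u`: lift the generalisation `w` of `p u` along the flat (generalising) `p`
    obtain ⟨u', hu'u, hu'⟩ := (Flat.generalizingMap (proj k T).left) hu
    rw [← specializes_iff_mem_closure]
    refine Specializes.trans ?_ hu'u
    -- `u'` lies in the fibre of `v`, whose generic point is `v`
    have hmem : u' ∈ Set.range ((proj k T).left.fiberι ((proj k T).left.base v)).base := by
      rw [Scheme.Hom.range_fiberι]
      exact hu'
    obtain ⟨x', hx'⟩ := hmem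
    have hgen : ((proj k T).left.fiberι ((proj k T).left.base v)).base (genericPoint _) = v := by
      rw [← hv]
      exact (proj k T).left.fiberι_asFiber v
    rw [← hgen, ← hx']
    exact (genericPoint_specializes x').map ((proj k T).left.fiberι _).continuous


variable [LocallyOfFiniteType T.hom]

/-- **Dimension over the base**: for a point `v` of `𝔸¹ ×ₖ T` over `w = p v`,
`dim closure {v} = dim closure {w} + dim_{fibre} closure {v}` with the fibre term `≤ 1`
(the dimension formula, Stacks 02JW, through the tree's `Scheme.height_eq_height_add_height_asFiber`).
[cite: StacksProject, Tag 02JW] -/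
theorem height_eq_height_base_add (v : ↥(𝔸₁ k ⊗ T).left) :
    height v = height ((proj k T).left.base v) + height ((proj k T).left.asFiber v) :=
  Scheme.height_eq_height_add_height_asFiber (proj k T).left T.hom v

/-- `dim closure {v} ≤ dim closure {p v} + 1` for every point `v` of `𝔸¹ ×ₖ T`.
[cite: StacksProject, Tag 02JW] -/
theorem height_le_height_base_add_one (v : ↥(𝔸₁ k ⊗ T).left) :
    height v ≤ height ((proj k T).left.base v) + 1 := by
  rw [height_eq_height_base_add v]
  gcongr
  exact height_le_one_of_fiber _

/-- A point `v` of `𝔸¹ ×ₖ T` with `dim closure {v} = dim closure {p v} + 1` (finite) is the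
generic point of its fibre. [cite: StacksProject, Tag 02JW] -/
theorem asFiber_eq_genericPoint_of_height_eq {v : ↥(𝔸₁ k ⊗ T).left} {m : ℕ}
    (hw : height ((proj k T).left.base v) = m) (hv : height v = m + 1) :
    (proj k T).left.asFiber v = genericPoint _ := by
  apply eq_genericPoint_of_height_eq_one
  have h := height_eq_height_base_add v
  rw [hw, hv] at h
  have hfin : height ((proj k T).left.asFiber v) ≠ ⊤ := by
    intro htop
    rw [htop, add_top] at h
    exact WithTop.coe_ne_top h
  obtain ⟨a, ha⟩ := ENat.ne_top_iff_exists.mp hfin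
  rw [← ha] at h ⊢
  have h' : m + 1 = m + a := by exact_mod_cast h
  have ha1 : a = 1 := by omega
  rw [ha1, Nat.cast_one]

end Points

/-! ### Pull-back of prime cycles: `p^*[closure {w}] = [p⁻¹(closure {w})]` is a prime cycle -/

section PrimeCyclePullback

variable {k T}

/-- The generic point of the fibre of `𝔸¹ ×ₖ T → T` over `w`, as a point of `𝔸¹ ×ₖ T`: the
generic point of `p⁻¹(closure {w}) = 𝔸¹ × closure {w}`. [folklore] -/
abbrev fibreGeneric (w : ↥T.left) : ↥(𝔸₁ k ⊗ T).left :=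
  ((proj k T).left.fiberι w).base (genericPoint _)

/-- `fibreGeneric w` lies over `w`. [folklore] -/
theorem proj_fibreGeneric (w : ↥T.left) : (proj k T).left.base (fibreGeneric w) = w :=
  base_fiberι_base _ _ _

/-- **`closure {fibreGeneric w} = p⁻¹(closure {w})`** (the flat `p` is generalising, and the
fibre over `w` is the closure of its generic point). [cite: Fulton1998, Prop. 1.9 (proof)] -/
theorem closure_fibreGeneric (w : ↥T.left) :
    closure {fibreGeneric (k := k) w} = (proj k T).left.base ⁻¹' closure {w} := by
  apply le_antisymm
  · refine closure_minimal (Set.singleton_subset_iff.mpr ?_)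
      ((isClosed_closure).preimage (proj k T).left.continuous)
    rw [Set.mem_preimage, proj_fibreGeneric]
    exact subset_closure (Set.mem_singleton w)
  · intro u hu
    rw [Set.mem_preimage, ← specializes_iff_mem_closure] at hu
    obtain ⟨u', hu'u, hu'⟩ := (Flat.generalizingMap (proj k T).left) hu
    rw [← specializes_iff_mem_closure]
    refine Specializes.trans ?_ hu'u
    have hmem : u' ∈ Set.range ((proj k T).left.fiberι w).base := by
      rw [Scheme.Hom.range_fiberι]
      exact hu'
    obtain ⟨x', hx'⟩ := hmem
    rw [← hx']
    exact (genericPoint_specializes x').map ((proj k T).left.fiberι w).continuous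

/-- In a scheme (a `T₀` space) a point is determined by its closure. [folklore] -/
theorem eq_of_closure_eq {Y : Scheme.{u}} {a b : ↥Y}
    (h : closure ({a} : Set ↥Y) = closure {b}) : a = b :=
  ((specializes_iff_closure_subset.mpr h.ge).antisymm (specializes_iff_closure_subset.mpr h.le)).eq

/-- A fibre-generic point of `𝔸¹ ×ₖ T` is `fibreGeneric` of its image. [folklore] -/
theorem eq_fibreGeneric_of_asFiber_eq {v : ↥(𝔸₁ k ⊗ T).left}
    (hv : (proj k T).left.asFiber v = genericPoint _) :
    v = fibreGeneric ((proj k T).left.base v) :=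
  eq_of_closure_eq ((closure_eq_preimage_closure_of_asFiber_eq hv).trans
    (closure_fibreGeneric _).symm)

variable [IsLocallyNoetherian T.left]

/-- `𝔸¹ ×ₖ T` is locally Noetherian for `T` locally Noetherian. [folklore] -/
instance isLocallyNoetherian_total : IsLocallyNoetherian (𝔸₁ k ⊗ T).left :=
  LocallyOfFiniteType.isLocallyNoetherian (proj k T).left

/-- The inverse image scheme `p⁻¹(closure {w})` of the closed subvariety `closure {w} ⊆ T`
(`ClosedSubvariety.ofPoint`, reduced structure) — a closed subscheme of `𝔸¹ ×ₖ T`. [folklore] -/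
abbrev preimageOfPoint (w : ↥T.left) : ClosedSubscheme (𝔸₁ k ⊗ T).left :=
  (ClosedSubvariety.ofPoint T.left w).toClosedSubscheme.preimage (proj k T).left

omit [IsLocallyNoetherian T.left] in
/-- The underlying set of `p⁻¹(closure {w})` is `p⁻¹(closure {w})`. [folklore] -/
theorem range_preimageOfPoint_ι (w : ↥T.left) :
    Set.range (preimageOfPoint (k := k) w).ι.base = (proj k T).left.base ⁻¹' closure {w} := by
  change Set.range (pullback.snd (ClosedSubvariety.ofPoint T.left w).ι (proj k T).left).base = _
  rw [Scheme.Pullback.range_snd, ClosedSubvariety.range_ofPoint_ι]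

/-- `closure {w}` with its reduced structure, as a `k`-scheme. [folklore] -/
abbrev baseOfPoint (w : ↥T.left) : SchemeOver k :=
  Over.mk ((ClosedSubvariety.ofPoint T.left w).ι ≫ T.hom)

/-- `closure {w}` (reduced structure) is an integral scheme. [folklore] -/
instance (w : ↥T.left) : IsIntegral (baseOfPoint (k := k) w).left :=
  (ClosedSubvariety.ofPoint T.left w).isIntegral

/-- `closure {w}` is locally Noetherian (a closed subscheme of the locally Noetherian `T`).
[folklore] -/
instance (w : ↥T.left) : IsLocallyNoetherian (baseOfPoint (k := k) w).left :=
  inferInstanceAs (IsLocallyNoetherian (ClosedSubvariety.ofPoint T.left w).toClosedSubscheme.carrier)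

/-- **`p⁻¹(closure {w}) ≅ 𝔸¹ ×ₖ closure {w}`** (pullback pasting). [folklore] -/
def preimageOfPointIso (w : ↥T.left) :
    (preimageOfPoint (k := k) w).carrier ≅ (𝔸₁ k ⊗ baseOfPoint (k := k) w).left :=
  pullbackSymmetry _ _ ≪≫
    pullbackLeftPullbackSndIso (𝔸₁ k).hom T.hom (ClosedSubvariety.ofPoint T.left w).ι

/-- `p⁻¹(closure {w})` is an integral scheme (it is `𝔸¹ ×ₖ closure {w}`). [folklore] -/
instance isIntegral_preimageOfPoint (w : ↥T.left) : IsIntegral (preimageOfPoint (k := k) w).carrier :=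
  haveI : Nonempty ↥(preimageOfPoint (k := k) w).carrier :=
    ⟨(preimageOfPointIso w).inv.base (genericPoint _)⟩
  isIntegral_of_isOpenImmersion (preimageOfPointIso w).hom

/-- The generic point of `p⁻¹(closure {w})` is the generic point of the fibre over `w`.
[folklore] -/
theorem preimageOfPoint_ι_genericPoint (w : ↥T.left) :
    (preimageOfPoint (k := k) w).ι.base (genericPoint _) = fibreGeneric w := by
  apply eq_of_closure_eq
  rw [closure_fibreGeneric, ← range_preimageOfPoint_ι, ← Set.image_singleton,
    (preimageOfPoint (k := k) w).ι.isClosedEmbedding.closure_image_eq, genericPoint_closure,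
    Set.image_univ]

/-- The cycle of `p⁻¹(closure {w})` is the prime cycle of the generic point of the fibre over `w`.
[cite: Fulton1998, §1.5 and Lemma 1.7.1] -/
theorem cycle_preimageOfPoint (hZ : locallyFinsupp_fundamentalCycleFun.{u}) (w : ↥T.left) :
    (preimageOfPoint (k := k) w).cycle hZ = primeCycle (fibreGeneric w) := by
  rw [ClosedSubscheme.cycle, fundamentalCycle_of_isIntegral_holds _ hZ, algebraicCycleMap_primeCycle,
    preimageOfPoint_ι_genericPoint]

/-- **Fulton, Lemma 1.7.1 for `p : 𝔸¹ ×ₖ T → T` on a prime cycle: `p^*[closure {w}] =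
[p⁻¹(closure {w})]`, a PRIME cycle** (the inverse image of the subvariety `closure {w}` is the
integral scheme `𝔸¹ × closure {w}`). [cite: Fulton1998, Lemma 1.7.1] -/
theorem flatPullback_primeCycle (hf : locallyFinsupp_flatPullbackFun.{u})
    (hZ : locallyFinsupp_fundamentalCycleFun.{u}) (w : ↥T.left) :
    flatPullback (proj k T).left hf (primeCycle w) = primeCycle (fibreGeneric w) := by
  have h1 : primeCycle w = (ClosedSubvariety.ofPoint T.left w).toClosedSubscheme.cycle hZ := by
    rw [ClosedSubvariety.cycle_toClosedSubscheme_holds, ClosedSubvariety.genericPoint_ofPoint]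
  rw [h1, flatPullback_cycle_eq_cycle_preimage_holds (proj k T).left hf hZ]
  exact cycle_preimageOfPoint hZ w

/-- **A subvariety of `𝔸¹ ×ₖ T` of dimension one more than its image is a pull-back**: if
`dim closure {v} = dim closure {p v} + 1` then `[closure {v}] = p^*[closure {p v}]`
(Fulton, proof of Prop. 1.9: "If `dim X = k`, then `V = E`, so `V = p^*[X]`" and
"`Vᵢ = p⁻¹(Wᵢ)`"). [cite: Fulton1998, Prop. 1.9 (proof)] -/
theorem primeCycle_eq_flatPullback_of_height_eq [LocallyOfFiniteType T.hom]
    (hf : locallyFinsupp_flatPullbackFun.{u}) (hZ : locallyFinsupp_fundamentalCycleFun.{u})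
    {v : ↥(𝔸₁ k ⊗ T).left} {m : ℕ} (hw : height ((proj k T).left.base v) = m)
    (hv : height v = m + 1) :
    primeCycle v = flatPullback (proj k T).left hf (primeCycle ((proj k T).left.base v)) := by
  rw [flatPullback_primeCycle hf hZ]
  congr 1
  exact eq_fibreGeneric_of_asFiber_eq (asFiber_eq_genericPoint_of_height_eq hw hv)

end PrimeCyclePullback

end AffineLineProduct

end Literature.AlgebraicGeometry.Motives

end
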